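/-
Copyright (c) 2026 the pub-hodgecm-mathlib formalisation cell (harness21).  Prover seat hodgecm-mathlib-F0P3a-p07 (g16): line LH3 (closer stub `stub_N9`), organ J,
brick (J-CONST) (β) «uniqueness + scaling of the two rank-one constants» (LH10-p02 (g4) 07:55:32Z (iii); F0P3a-p07 (g16) default 08:04Z), 2026-09-02.
-/
import Literature.NumberTheory.Automorphic.ArchRankOneJumpZeroCone               -- ★ p850353 (this seat): the generic-`J` (K0±) heads, `cayley_conj_circleDiagonal_mem_of_eq_over`
import Literature.NumberTheory.Automorphic.ArchRankOneSplitConeMatching          -- ★ p850345 (F0P3a-p05): the (A0-c) head; brings ★ p850302 `integral_addCircle_prod_coneChart_eq_two_smul_cone`, `exists_bound_coneChart`, `continuous_coneChart_addCircle`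
import Literature.NumberTheory.Automorphic.Shelstad1979.OneSidedJumpUnique       -- ★ p850311 (F0P3a-p04): `HasOneSidedJump.eq_of_mul_ne_zero`
import HarnessLib

/-!
# The two rank-one constants of organ J are UNIQUE given the measure and SCALE with it: `C₁` of (K0±) and `C₂` of (A0)
# (Varadarajan 1989 §6.4 Thm 23; Shelstad 1979 §4 Lemma 4.3; Rogawski 1990 §8.2)

Topic `NumberTheory/Automorphic`; namespace `Literature.NumberTheory.Automorphic.UnitaryGroup`.  THEOREMS ONLY (no `def`, no instance, no notation, no axiom, no named fact, no
`sorry`).  Cell `pub/hodgecm-mathlib`, line LH3 (closer stub `stub_N9`, crux H413 = `stmt-HodgeConjecture-24833`), organ J, brick **(J-CONST) (β)** (LH10-p02 (g4) 2026-09-02T07:55:32Z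
(iii): «∃-witnesses obtained in different files are not comparable terms»; F0P3a-p07 (g16) default 08:04Z).  The (BOOK) hypothesis `cH = 2·cG′` of ★ (J-HEAD)
`agreesOnAdmissibleCoveredSlots_of_bricks` compares the H-side ratio `2i·C₁∕(C₂·…)` with the G′-side ratio `i·C₁′∕(C₂′·…)`, where `C₁, C₁′` are (K0±) witnesses (★ p850055 ∕
★ p850353) and `C₂, C₂′` are (A0-c) witnesses (★ p850345) for possibly different Haar data.  This file supplies the two facts that make such witnesses comparable on the generic carrier
`U(J)`, `hJ : J = (StdForm.antidiagonal 2).over ℂ`: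
* §1 **a non-negative test function with non-zero cone value**: for every `z ≠ 0` there is `f ∈ C_c(M₂(ℂ), ℂ)`, real and non-negative, with `cone⁺(f, z) + cone⁻(f, z) ≠ 0` (the two
  half-cone integrals of ★ p850055 ∕ p850302, token for token) — Urysohn bump `= 1` at `z·1`, read through ★ `integral_addCircle_prod_coneChart_eq_two_smul_cone` as the integral of a
  continuous non-negative compactly supported function on `ℝ∕2πℤ × ℝ`, positive at `(0, 0)`.
* §2 **(K0±)**: `eq_of_hasOneSidedJump_cone` — two constants with the (K0±) jump property for the same `(U(J), ν)` coincide (★ `HasOneSidedJump.eq_of_mul_ne_zero` at §1's `f`);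
  `hasOneSidedJump_cone_smul_measure` — the property for `(ν, C₁)` gives the property for `(c • ν, c.toReal·C₁)`.
* §3 **(A0-c)**: `eq_of_tendsto_cone` — two constants with the (A0-c) limit property for the same quotient measure `μ` coincide (`tendsto_nhds_unique` on `𝓝[≠] 0`);
  `tendsto_cone_smul_measure` — `(μ, C₂) ⇒ (c • μ, c.toReal·C₂)`.  (The quotient measure is linear in the Haar measure of the group: ★ `quotientMeasure_smul_measure`.)
So for Haar data differing by scalars the BOOK ratio `C₁∕C₂` is the same number on both sides; the frame is free because `J` is a variable (`subst hJ`).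
HONEST LABEL: HC_CM is proved only modulo the 7 printed citations (2 remaining: hLiu418 = stmt-HodgeConjecture-24832, h413 = stmt-HodgeConjecture-24833) until rung 0 closes; bookkeeping
over ★ bricks, count-neutral, pays nothing by itself.

## References
* [Varadarajan1989] V. S. Varadarajan, *An Introduction to Harmonic Analysis on Semisimple Lie Groups*, Cambridge Stud. Adv. Math. 16 (1989), §6.4 Lemma 21 (c), Thm 23.
* [Shelstad1979] D. Shelstad, *Characters and inner forms of a quasi-split group over ℝ*, Compositio Math. 39 (1979), §4 Lemma 4.3 p. 25, Prop. 4.5 p. 26.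
* [Rogawski1990] J. D. Rogawski, *Automorphic Representations of Unitary Groups in Three Variables*, Ann. of Math. Stud. 123 (1990), §8.2 pp. 119, 122–123.
-/

set_option autoImplicit false

noncomputable section

namespace Literature.NumberTheory.Automorphic.UnitaryGroup

open _root_.MeasureTheory Measure Set Filter _root_.Topology _root_.Complex
open Literature.NumberTheory.Automorphic.Shelstad1979.StableOrbitalIntegrals Literature.MeasureTheory.Group
open scoped Real MatrixGroups ENNReal

/-! ## §1 A non-negative test function whose two-nappe cone value is non-zero -/

/-- **For every `z ≠ 0` some real non-negative `f ∈ C_c(M₂(ℂ), ℂ)` has `cone⁺(f, z) + cone⁻(f, z) ≠ 0`** (the half-cone integrals of ★ p850055 in the Cayley frame, token for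
token).  Proof: an Urysohn function `g ∈ C_c(M₂(ℂ), [0,1])` with `g(z·1) = 1`; by ★ `integral_addCircle_prod_coneChart_eq_two_smul_cone`, `2·(cone⁺ + cone⁻)(g)` is the integral
over `ℝ∕2πℤ × ℝ` of the continuous compactly supported non-negative function `(s,u) ↦ g(z·(1 + iu·A(s)))`, which is `1` at `(0,0)`. [cite: Varadarajan1989, §6.4 Lemma 21 (c)] -/
theorem exists_nonneg_cone_ne_zero [Fact (0 < 2 * π)] (z : ℂ) (hz : z ≠ 0) :
    ∃ f : Matrix (Fin 2) (Fin 2) ℂ → ℂ, Continuous f ∧ HasCompactSupport f ∧ (∀ X, 0 ≤ (f X).re ∧ (f X).im = 0) ∧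
      ((∫ p in Ioi (0 : ℝ) ×ˢ Ioc (0 : ℝ) (2 * π),
          f ((!![(1 : ℂ), 1; 1, -1] : Matrix (Fin 2) (Fin 2) ℂ) *
            (z • (1 : Matrix (Fin 2) (Fin 2) ℂ) + p.1 • Matrix.diagonal ![z * Complex.I, -(z * Complex.I)] +
              p.1 • !![(0 : ℂ), -(z * Complex.I) * Complex.exp (-((p.2 : ℂ) * Complex.I)); (z * Complex.I) * Complex.exp ((p.2 : ℂ) * Complex.I), 0]) *
            !![(1 / 2 : ℂ), 1 / 2; 1 / 2, -(1 / 2)])) +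
        ∫ p in Ioi (0 : ℝ) ×ˢ Ioc (0 : ℝ) (2 * π),
          f ((!![(1 : ℂ), 1; 1, -1] : Matrix (Fin 2) (Fin 2) ℂ) *
            (z • (1 : Matrix (Fin 2) (Fin 2) ℂ) + p.1 • Matrix.diagonal ![-(z * Complex.I), z * Complex.I] +
              p.1 • !![(0 : ℂ), (z * Complex.I) * Complex.exp (-((p.2 : ℂ) * Complex.I)); -(z * Complex.I) * Complex.exp ((p.2 : ℂ) * Complex.I), 0]) *
            !![(1 / 2 : ℂ), 1 / 2; 1 / 2, -(1 / 2)])) ≠ 0 := by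
  haveI : LocallyCompactSpace (Matrix (Fin 2) (Fin 2) ℂ) := inferInstanceAs (LocallyCompactSpace (Fin 2 → Fin 2 → ℂ))
  -- the Urysohn bump at `z·1`
  obtain ⟨g, hg1, -, hgc, hg01⟩ := exists_continuous_one_zero_of_isCompact (isCompact_singleton (x := z • (1 : Matrix (Fin 2) (Fin 2) ℂ))) isClosed_empty
    (Set.disjoint_empty _)
  refine ⟨fun X => ((g X : ℝ) : ℂ), Complex.continuous_ofReal.comp g.continuous, hgc.comp_left Complex.ofReal_zero,
    fun X => ⟨by simpa using (hg01 X).1, by simp⟩, ?_⟩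
  have hf : Continuous (fun X : Matrix (Fin 2) (Fin 2) ℂ => ((g X : ℝ) : ℂ)) := Complex.continuous_ofReal.comp g.continuous
  have hfc : HasCompactSupport (fun X : Matrix (Fin 2) (Fin 2) ℂ => ((g X : ℝ) : ℂ)) := hgc.comp_left Complex.ofReal_zero
  have key := integral_addCircle_prod_coneChart_eq_two_smul_cone (fun X : Matrix (Fin 2) (Fin 2) ℂ => ((g X : ℝ) : ℂ)) hf hfc z hz
  -- the real integrand on `ℝ∕2πℤ × ℝ`
  obtain ⟨G, hG⟩ : ∃ G : AddCircle (2 * π) × ℝ → ℝ, G = fun p => g (z • ((1 : Matrix (Fin 2) (Fin 2) ℂ) + (((p.2 : ℝ) : ℂ) * Complex.I) •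
      !![Complex.I * ((Real.Angle.sin p.1 : ℝ) : ℂ) * ((Real.Angle.cos p.1 : ℝ) : ℂ), ((Real.Angle.cos p.1 : ℝ) : ℂ) ^ 2;
        ((Real.Angle.sin p.1 : ℝ) : ℂ) ^ 2, -(Complex.I * ((Real.Angle.sin p.1 : ℝ) : ℂ) * ((Real.Angle.cos p.1 : ℝ) : ℂ))])) := ⟨_, rfl⟩
  have hGc : Continuous G := by
    have h := Complex.continuous_re.comp (continuous_coneChart_addCircle (fun X : Matrix (Fin 2) (Fin 2) ℂ => ((g X : ℝ) : ℂ)) hf z)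
    rw [hG]
    convert h using 1
    funext p
    simp
  -- compact support of `G` (the `u`-bound of ★ `exists_bound_coneChart`)
  obtain ⟨R, -, hzero⟩ := exists_bound_coneChart (fun X : Matrix (Fin 2) (Fin 2) ℂ => ((g X : ℝ) : ℂ)) hfc z hz
  have hGsupp : HasCompactSupport G := by
    refine HasCompactSupport.intro (isCompact_univ.prod (isCompact_Icc (a := -R) (b := R))) fun p hp => ?_
    obtain ⟨a, ha⟩ : ∃ a : ℝ, (a : AddCircle (2 * π)) = p.1 := QuotientAddGroup.mk_surjective p.1
    have hp' : R ≤ |p.2| := by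
      by_contra hlt
      exact hp (mk_mem_prod (mem_univ _) (abs_le.1 (not_le.1 hlt).le))
    have h0 := hzero a p.2 hp'
    rw [hG]
    beta_reduce
    rw [← ha, Literature.MeasureTheory.Group.cosA_coe, Literature.MeasureTheory.Group.sinA_coe]
    exact_mod_cast h0
  have hG0 : ∀ p, 0 ≤ G p := fun p => by rw [hG]; exact (hg01 _).1
  have hG1 : G (((0 : ℝ) : AddCircle (2 * π)), 0) ≠ 0 := by
    rw [hG]
    beta_reduce
    have h1 : g (z • (1 : Matrix (Fin 2) (Fin 2) ℂ)) = 1 := hg1 rfl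
    simp [h1]
  have hpos : 0 < ∫ p, G p ∂((volume : Measure (AddCircle (2 * π))).prod (volume : Measure ℝ)) :=
    hGc.integral_pos_of_hasCompactSupport_nonneg_nonzero hGsupp hG0 hG1
  -- the complex integral is the real one
  have hint : ∫ p : AddCircle (2 * π) × ℝ, (fun X : Matrix (Fin 2) (Fin 2) ℂ => ((g X : ℝ) : ℂ)) (z • ((1 : Matrix (Fin 2) (Fin 2) ℂ) + (((p.2 : ℝ) : ℂ) * Complex.I) •
        !![Complex.I * ((Real.Angle.sin p.1 : ℝ) : ℂ) * ((Real.Angle.cos p.1 : ℝ) : ℂ), ((Real.Angle.cos p.1 : ℝ) : ℂ) ^ 2;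
          ((Real.Angle.sin p.1 : ℝ) : ℂ) ^ 2, -(Complex.I * ((Real.Angle.sin p.1 : ℝ) : ℂ) * ((Real.Angle.cos p.1 : ℝ) : ℂ))])) ∂(volume.prod volume) =
      ((∫ p, G p ∂((volume : Measure (AddCircle (2 * π))).prod (volume : Measure ℝ)) : ℝ) : ℂ) := by
    rw [hG]
    exact integral_ofReal
  rw [hint] at key
  intro h0
  rw [h0, smul_zero, Complex.ofReal_eq_zero] at key
  exact hpos.ne' key

/-! ## §2 (K0±): the jump constant is unique given `(U(J), ν)` and scales with `ν` -/

variable {J : Matrix (Fin 2) (Fin 2) ℂ} (hJ : J = (StdForm.antidiagonal 2).over ℂ)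

include hJ in
/-- **UNIQUENESS OF THE (K0±) CONSTANT.**  If `C` and `C′` both have the (K0±) jump property for `(U(J), ν)` — for every `f ∈ C_c(M₂(ℂ), ℂ)` and `z ∈ S¹` the normalised elliptic orbital
integral jumps by `C · (cone⁺ + cone⁻)(f, z)`, resp. `C′ · (…)` — then `C = C′` (★ `HasOneSidedJump.eq_of_mul_ne_zero` at §1's `f`, `z = 1`). [cite: Shelstad1979, §4 Lemma 4.3, Prop. 4.5] -/
theorem eq_of_hasOneSidedJump_cone [Fact (0 < 2 * π)]
    [MeasurableSpace ↥(unitaryGroupOfForm (starRingEnd ℂ) J)] [BorelSpace ↥(unitaryGroupOfForm (starRingEnd ℂ) J)]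
    (ν : Measure ↥(unitaryGroupOfForm (starRingEnd ℂ) J)) {C C' : ℂ}
    (hC : ∀ (f : Matrix (Fin 2) (Fin 2) ℂ → ℂ), Continuous f → HasCompactSupport f → ∀ z : Circle,
        HasOneSidedJump (fun ψ : ℝ => (2 * Real.sin ψ : ℂ) *
            ∫ h : ↥(unitaryGroupOfForm (starRingEnd ℂ) J),
              f (((h * ⟨Matrix.GeneralLinearGroup.mkOfDetNeZero !![(1 : ℂ), 1; 1, -1] det_cayleyTwo_ne_zero *
                    circleDiagonal 2 ![z * Circle.exp ψ, z * Circle.exp (-ψ)] *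
                    (Matrix.GeneralLinearGroup.mkOfDetNeZero !![(1 : ℂ), 1; 1, -1] det_cayleyTwo_ne_zero)⁻¹,
                  cayley_conj_circleDiagonal_mem_of_eq_over hJ _⟩ * h⁻¹ :
                ↥(unitaryGroupOfForm (starRingEnd ℂ) J)) : GL (Fin 2) ℂ) : Matrix (Fin 2) (Fin 2) ℂ) ∂ν)
          (C * ((∫ p in Ioi (0 : ℝ) ×ˢ Ioc (0 : ℝ) (2 * π),
              f ((!![(1 : ℂ), 1; 1, -1] : Matrix (Fin 2) (Fin 2) ℂ) *
                ((z : ℂ) • (1 : Matrix (Fin 2) (Fin 2) ℂ) + p.1 • Matrix.diagonal ![(z : ℂ) * I, -((z : ℂ) * I)] +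
                  p.1 • !![(0 : ℂ), -((z : ℂ) * I) * cexp (-((p.2 : ℂ) * I)); ((z : ℂ) * I) * cexp ((p.2 : ℂ) * I), 0]) *
                !![(1 / 2 : ℂ), 1 / 2; 1 / 2, -(1 / 2)])) +
            ∫ p in Ioi (0 : ℝ) ×ˢ Ioc (0 : ℝ) (2 * π),
              f ((!![(1 : ℂ), 1; 1, -1] : Matrix (Fin 2) (Fin 2) ℂ) *
                ((z : ℂ) • (1 : Matrix (Fin 2) (Fin 2) ℂ) + p.1 • Matrix.diagonal ![-((z : ℂ) * I), (z : ℂ) * I] +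
                  p.1 • !![(0 : ℂ), ((z : ℂ) * I) * cexp (-((p.2 : ℂ) * I)); -((z : ℂ) * I) * cexp ((p.2 : ℂ) * I), 0]) *
                !![(1 / 2 : ℂ), 1 / 2; 1 / 2, -(1 / 2)]))))
    (hC' : ∀ (f : Matrix (Fin 2) (Fin 2) ℂ → ℂ), Continuous f → HasCompactSupport f → ∀ z : Circle,
        HasOneSidedJump (fun ψ : ℝ => (2 * Real.sin ψ : ℂ) *
            ∫ h : ↥(unitaryGroupOfForm (starRingEnd ℂ) J),
              f (((h * ⟨Matrix.GeneralLinearGroup.mkOfDetNeZero !![(1 : ℂ), 1; 1, -1] det_cayleyTwo_ne_zero *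
                    circleDiagonal 2 ![z * Circle.exp ψ, z * Circle.exp (-ψ)] *
                    (Matrix.GeneralLinearGroup.mkOfDetNeZero !![(1 : ℂ), 1; 1, -1] det_cayleyTwo_ne_zero)⁻¹,
                  cayley_conj_circleDiagonal_mem_of_eq_over hJ _⟩ * h⁻¹ :
                ↥(unitaryGroupOfForm (starRingEnd ℂ) J)) : GL (Fin 2) ℂ) : Matrix (Fin 2) (Fin 2) ℂ) ∂ν)
          (C' * ((∫ p in Ioi (0 : ℝ) ×ˢ Ioc (0 : ℝ) (2 * π),
              f ((!![(1 : ℂ), 1; 1, -1] : Matrix (Fin 2) (Fin 2) ℂ) *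
                ((z : ℂ) • (1 : Matrix (Fin 2) (Fin 2) ℂ) + p.1 • Matrix.diagonal ![(z : ℂ) * I, -((z : ℂ) * I)] +
                  p.1 • !![(0 : ℂ), -((z : ℂ) * I) * cexp (-((p.2 : ℂ) * I)); ((z : ℂ) * I) * cexp ((p.2 : ℂ) * I), 0]) *
                !![(1 / 2 : ℂ), 1 / 2; 1 / 2, -(1 / 2)])) +
            ∫ p in Ioi (0 : ℝ) ×ˢ Ioc (0 : ℝ) (2 * π),
              f ((!![(1 : ℂ), 1; 1, -1] : Matrix (Fin 2) (Fin 2) ℂ) *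
                ((z : ℂ) • (1 : Matrix (Fin 2) (Fin 2) ℂ) + p.1 • Matrix.diagonal ![-((z : ℂ) * I), (z : ℂ) * I] +
                  p.1 • !![(0 : ℂ), ((z : ℂ) * I) * cexp (-((p.2 : ℂ) * I)); -((z : ℂ) * I) * cexp ((p.2 : ℂ) * I), 0]) *
                !![(1 / 2 : ℂ), 1 / 2; 1 / 2, -(1 / 2)])))) :
    C = C' := by
  obtain ⟨f, hf, hfc, -, hne⟩ := exists_nonneg_cone_ne_zero ((1 : Circle) : ℂ) (Circle.coe_ne_zero 1)
  exact (hC f hf hfc 1).eq_of_mul_ne_zero (hC' f hf hfc 1) hne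

omit hJ in
/-- A constant multiple of a function with a one-sided jump has the scaled jump (★ twin, kept private to avoid an import). [cite: Shelstad1979, §4 p. 22] -/
private theorem hasOneSidedJump_const_mul' {F : ℝ → ℂ} {Jp : ℂ} (a : ℂ) (h : HasOneSidedJump F Jp) :
    HasOneSidedJump (fun ν => a * F ν) (a * Jp) := by
  obtain ⟨Lp, Lm, hp, hm, hJ⟩ := h
  exact ⟨a * Lp, a * Lm, hp.const_mul a, hm.const_mul a, by rw [← hJ]; ring⟩

include hJ in
/-- **SCALING OF THE (K0±) CONSTANT WITH THE MEASURE.**  If `C` has the (K0±) jump property for `(U(J), ν)` (one `f`, one `z`), then `c.toReal · C` has it for `(U(J), c • ν)`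
(`∫ ∂(c • ν) = c.toReal • ∫ ∂ν`). [cite: Shelstad1979, §4 Lemma 4.3] -/
theorem hasOneSidedJump_cone_smul_measure
    [MeasurableSpace ↥(unitaryGroupOfForm (starRingEnd ℂ) J)]
    (ν : Measure ↥(unitaryGroupOfForm (starRingEnd ℂ) J)) (c : ℝ≥0∞) {C V : ℂ} (f : Matrix (Fin 2) (Fin 2) ℂ → ℂ) (z : Circle)
    (hC : HasOneSidedJump (fun ψ : ℝ => (2 * Real.sin ψ : ℂ) *
            ∫ h : ↥(unitaryGroupOfForm (starRingEnd ℂ) J),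
              f (((h * ⟨Matrix.GeneralLinearGroup.mkOfDetNeZero !![(1 : ℂ), 1; 1, -1] det_cayleyTwo_ne_zero *
                    circleDiagonal 2 ![z * Circle.exp ψ, z * Circle.exp (-ψ)] *
                    (Matrix.GeneralLinearGroup.mkOfDetNeZero !![(1 : ℂ), 1; 1, -1] det_cayleyTwo_ne_zero)⁻¹,
                  cayley_conj_circleDiagonal_mem_of_eq_over hJ _⟩ * h⁻¹ :
                ↥(unitaryGroupOfForm (starRingEnd ℂ) J)) : GL (Fin 2) ℂ) : Matrix (Fin 2) (Fin 2) ℂ) ∂ν)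
          (C * V)) :
    HasOneSidedJump (fun ψ : ℝ => (2 * Real.sin ψ : ℂ) *
            ∫ h : ↥(unitaryGroupOfForm (starRingEnd ℂ) J),
              f (((h * ⟨Matrix.GeneralLinearGroup.mkOfDetNeZero !![(1 : ℂ), 1; 1, -1] det_cayleyTwo_ne_zero *
                    circleDiagonal 2 ![z * Circle.exp ψ, z * Circle.exp (-ψ)] *
                    (Matrix.GeneralLinearGroup.mkOfDetNeZero !![(1 : ℂ), 1; 1, -1] det_cayleyTwo_ne_zero)⁻¹,
                  cayley_conj_circleDiagonal_mem_of_eq_over hJ _⟩ * h⁻¹ :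
                ↥(unitaryGroupOfForm (starRingEnd ℂ) J)) : GL (Fin 2) ℂ) : Matrix (Fin 2) (Fin 2) ℂ) ∂(c • ν))
          ((c.toReal : ℂ) * C * V) := by
  have h := hasOneSidedJump_const_mul' (c.toReal : ℂ) hC
  rw [← mul_assoc] at h
  have hfun : (fun ψ : ℝ => (2 * Real.sin ψ : ℂ) *
      ∫ h : ↥(unitaryGroupOfForm (starRingEnd ℂ) J),
        f (((h * ⟨Matrix.GeneralLinearGroup.mkOfDetNeZero !![(1 : ℂ), 1; 1, -1] det_cayleyTwo_ne_zero *
              circleDiagonal 2 ![z * Circle.exp ψ, z * Circle.exp (-ψ)] *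
              (Matrix.GeneralLinearGroup.mkOfDetNeZero !![(1 : ℂ), 1; 1, -1] det_cayleyTwo_ne_zero)⁻¹,
            cayley_conj_circleDiagonal_mem_of_eq_over hJ _⟩ * h⁻¹ :
          ↥(unitaryGroupOfForm (starRingEnd ℂ) J)) : GL (Fin 2) ℂ) : Matrix (Fin 2) (Fin 2) ℂ) ∂(c • ν)) =
      fun ψ : ℝ => (c.toReal : ℂ) * ((2 * Real.sin ψ : ℂ) *
        ∫ h : ↥(unitaryGroupOfForm (starRingEnd ℂ) J),
          f (((h * ⟨Matrix.GeneralLinearGroup.mkOfDetNeZero !![(1 : ℂ), 1; 1, -1] det_cayleyTwo_ne_zero *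
                circleDiagonal 2 ![z * Circle.exp ψ, z * Circle.exp (-ψ)] *
                (Matrix.GeneralLinearGroup.mkOfDetNeZero !![(1 : ℂ), 1; 1, -1] det_cayleyTwo_ne_zero)⁻¹,
              cayley_conj_circleDiagonal_mem_of_eq_over hJ _⟩ * h⁻¹ :
            ↥(unitaryGroupOfForm (starRingEnd ℂ) J)) : GL (Fin 2) ℂ) : Matrix (Fin 2) (Fin 2) ℂ) ∂ν) := by
    funext ψ
    rw [integral_smul_measure, Complex.real_smul]
    ring
  rw [hfun]
  exact h

/-! ## §3 (A0-c): the limit constant is unique given the quotient measure `μ` and scales with `μ` -/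

include hJ in
/-- **UNIQUENESS OF THE (A0-c) CONSTANT.**  If `C` and `C′` both have the (A0-c) limit property for the same measure `μ` on `U(J) ⧸ T` — for every `f ∈ C_c(M₂(ℂ), ℂ)` and `θ`,
`|eˣ − e⁻ˣ| • ∫ descConj(hypBlockGL x θ)(f ∘ coe) dμ → C • (cone⁺ + cone⁻)(f, e^{iθ})` as `x → 0`, `x ≠ 0` (★ p850345's conclusion, `E = ℂ`) — then `C = C′`
(`tendsto_nhds_unique` on the proper filter `𝓝[≠] 0`, at §1's `f`, `θ = 0`). [cite: Varadarajan1989, §6.4 Thm 23] [cite: Shelstad1979, §4 Lemma 4.3] -/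
theorem eq_of_tendsto_cone [Fact (0 < 2 * π)]
    [MeasurableSpace ↥(unitaryGroupOfForm (starRingEnd ℂ) J)]
    [MeasurableSpace (↥(unitaryGroupOfForm (starRingEnd ℂ) J) ⧸ torusU (starRingEnd ℂ) J)]
    (μ : Measure (↥(unitaryGroupOfForm (starRingEnd ℂ) J) ⧸ torusU (starRingEnd ℂ) J)) {C C' : ℝ}
    (hC : ∀ (f : Matrix (Fin 2) (Fin 2) ℂ → ℂ), Continuous f → HasCompactSupport f → ∀ θ : ℝ,
      Tendsto (fun x : ℝ => |Real.exp x - Real.exp (-x)| •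
          ∫ y, descConj (⟨hypBlockGL x θ, hypBlockGL_mem_of_eq_over hJ x θ⟩ : ↥(unitaryGroupOfForm (starRingEnd ℂ) J)) (torusU (starRingEnd ℂ) J)
            (LineRing.forall_mem_torusU_comm (starRingEnd ℂ) J (hypBlockGL_mem_torusU hJ x θ))
            (fun g : ↥(unitaryGroupOfForm (starRingEnd ℂ) J) => f ((g : GL (Fin 2) ℂ) : Matrix (Fin 2) (Fin 2) ℂ)) y ∂μ)
        (𝓝[≠] 0)
        (𝓝 (C • ((∫ p in Ioi (0 : ℝ) ×ˢ Ioc (0 : ℝ) (2 * π),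
            f ((!![(1 : ℂ), 1; 1, -1] : Matrix (Fin 2) (Fin 2) ℂ) *
              (Complex.exp ((θ : ℂ) * Complex.I) • (1 : Matrix (Fin 2) (Fin 2) ℂ) +
                p.1 • Matrix.diagonal ![Complex.exp ((θ : ℂ) * Complex.I) * Complex.I, -(Complex.exp ((θ : ℂ) * Complex.I) * Complex.I)] +
                p.1 • !![(0 : ℂ), -(Complex.exp ((θ : ℂ) * Complex.I) * Complex.I) * Complex.exp (-((p.2 : ℂ) * Complex.I));
                  (Complex.exp ((θ : ℂ) * Complex.I) * Complex.I) * Complex.exp ((p.2 : ℂ) * Complex.I), 0]) *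
              !![(1 / 2 : ℂ), 1 / 2; 1 / 2, -(1 / 2)])) +
          ∫ p in Ioi (0 : ℝ) ×ˢ Ioc (0 : ℝ) (2 * π),
            f ((!![(1 : ℂ), 1; 1, -1] : Matrix (Fin 2) (Fin 2) ℂ) *
              (Complex.exp ((θ : ℂ) * Complex.I) • (1 : Matrix (Fin 2) (Fin 2) ℂ) +
                p.1 • Matrix.diagonal ![-(Complex.exp ((θ : ℂ) * Complex.I) * Complex.I), Complex.exp ((θ : ℂ) * Complex.I) * Complex.I] +
                p.1 • !![(0 : ℂ), (Complex.exp ((θ : ℂ) * Complex.I) * Complex.I) * Complex.exp (-((p.2 : ℂ) * Complex.I));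
                  -(Complex.exp ((θ : ℂ) * Complex.I) * Complex.I) * Complex.exp ((p.2 : ℂ) * Complex.I), 0]) *
              !![(1 / 2 : ℂ), 1 / 2; 1 / 2, -(1 / 2)])))))
    (hC' : ∀ (f : Matrix (Fin 2) (Fin 2) ℂ → ℂ), Continuous f → HasCompactSupport f → ∀ θ : ℝ,
      Tendsto (fun x : ℝ => |Real.exp x - Real.exp (-x)| •
          ∫ y, descConj (⟨hypBlockGL x θ, hypBlockGL_mem_of_eq_over hJ x θ⟩ : ↥(unitaryGroupOfForm (starRingEnd ℂ) J)) (torusU (starRingEnd ℂ) J)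
            (LineRing.forall_mem_torusU_comm (starRingEnd ℂ) J (hypBlockGL_mem_torusU hJ x θ))
            (fun g : ↥(unitaryGroupOfForm (starRingEnd ℂ) J) => f ((g : GL (Fin 2) ℂ) : Matrix (Fin 2) (Fin 2) ℂ)) y ∂μ)
        (𝓝[≠] 0)
        (𝓝 (C' • ((∫ p in Ioi (0 : ℝ) ×ˢ Ioc (0 : ℝ) (2 * π),
            f ((!![(1 : ℂ), 1; 1, -1] : Matrix (Fin 2) (Fin 2) ℂ) *
              (Complex.exp ((θ : ℂ) * Complex.I) • (1 : Matrix (Fin 2) (Fin 2) ℂ) +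
                p.1 • Matrix.diagonal ![Complex.exp ((θ : ℂ) * Complex.I) * Complex.I, -(Complex.exp ((θ : ℂ) * Complex.I) * Complex.I)] +
                p.1 • !![(0 : ℂ), -(Complex.exp ((θ : ℂ) * Complex.I) * Complex.I) * Complex.exp (-((p.2 : ℂ) * Complex.I));
                  (Complex.exp ((θ : ℂ) * Complex.I) * Complex.I) * Complex.exp ((p.2 : ℂ) * Complex.I), 0]) *
              !![(1 / 2 : ℂ), 1 / 2; 1 / 2, -(1 / 2)])) +
          ∫ p in Ioi (0 : ℝ) ×ˢ Ioc (0 : ℝ) (2 * π),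
            f ((!![(1 : ℂ), 1; 1, -1] : Matrix (Fin 2) (Fin 2) ℂ) *
              (Complex.exp ((θ : ℂ) * Complex.I) • (1 : Matrix (Fin 2) (Fin 2) ℂ) +
                p.1 • Matrix.diagonal ![-(Complex.exp ((θ : ℂ) * Complex.I) * Complex.I), Complex.exp ((θ : ℂ) * Complex.I) * Complex.I] +
                p.1 • !![(0 : ℂ), (Complex.exp ((θ : ℂ) * Complex.I) * Complex.I) * Complex.exp (-((p.2 : ℂ) * Complex.I));
                  -(Complex.exp ((θ : ℂ) * Complex.I) * Complex.I) * Complex.exp ((p.2 : ℂ) * Complex.I), 0]) *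
              !![(1 / 2 : ℂ), 1 / 2; 1 / 2, -(1 / 2)]))))) :
    C = C' := by
  obtain ⟨f, hf, hfc, -, hne⟩ := exists_nonneg_cone_ne_zero (Complex.exp (((0 : ℝ) : ℂ) * Complex.I)) (Complex.exp_ne_zero _)
  have h := tendsto_nhds_unique (hC f hf hfc 0) (hC' f hf hfc 0)
  exact smul_left_injective ℝ hne h

/-- **SCALING OF THE (A0-c) CONSTANT WITH THE MEASURE** (one `f`, one `θ`, any Banach `E`): the limit property for `(μ, C)` gives it for `(c • μ, c.toReal·C)`. With ★
`quotientMeasure_smul_measure` (`(c • ν) ∕ ρ = c • (ν ∕ ρ)`) this is the scaling in the Haar measure of the group. [cite: Varadarajan1989, §6.4 Thm 23] -/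
theorem tendsto_cone_smul_measure {X : Type*} [MeasurableSpace X] (μ : Measure X) (c : ℝ≥0∞) {E : Type*} [NormedAddCommGroup E] [NormedSpace ℝ E]
    (Φ : ℝ → X → E) (w : ℝ → ℝ) {C : ℝ} {V : E}
    (hC : Tendsto (fun x : ℝ => w x • ∫ y, Φ x y ∂μ) (𝓝[≠] 0) (𝓝 (C • V))) :
    Tendsto (fun x : ℝ => w x • ∫ y, Φ x y ∂(c • μ)) (𝓝[≠] 0) (𝓝 ((c.toReal * C) • V)) := by
  have h := hC.const_smul c.toReal
  rw [smul_smul] at h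
  refine h.congr fun x => ?_
  rw [integral_smul_measure, smul_comm]

end Literature.NumberTheory.Automorphic.UnitaryGroup

end
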